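import Mathlib
import Literature.AlgebraicGeometry.Resolution.HypersurfaceHeightTwoWeightedCentre
import HarnessLib

/-!
# Door `HypersurfaceCentreConstruction` (stmt-ResolutionOfSingularities-19897), e-ladder rung `e = 1`: the lex-maximal weighted
# centre germ of Abramovich–Quek–Schober — transport along ring isomorphisms, invariance under automorphisms preserving
# the hypersurface germ, uniqueness of the data (OURS plumbing over the Literature fact F-AQS-T)

Route `ResolutionOfSingularities/WeightedInvariant`, crux `HypersurfaceCentreConstruction` (door line `local-engine`, e-ladder of
res-D-pv-025 AS stub-10).  [OURS · L1 W4.3 · support typer res-L1-type-o7 (seat res-D-pv-023)]  Folklore bookkeeping about the predicate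
`IsLexMaxWeightedCentreGerm` of `HypersurfaceHeightTwoWeightedCentre.lean` (Abramovich–Quek–Schober 2025,
arXiv:2507.01232, Def. 3.2–3.3, Thm 3.5 [cite: AbramovichQuekSchober2025]), written for the e-ladder rung `e = 1`
of the door `HypersurfaceCentreConstruction` (route `ResolutionOfSingularities/WeightedInvariant`; consumer:
res-D-pv-025's lemma L3 «(hom) for all torus charts», whose mechanism is AQS §5 (i) p. 11: "for every
`t ∈ T(k^sep)`, `t · J` is also a center … that satisfies the same properties, so by the uniqueness of `J`,
`t · J = J`"):

* `LexMaxCentre.map_ringEquiv` — the predicate is transported along ring ISOMORPHISMS of local rings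
  (regular systems of parameters, admissibility, lex-maximality and uniqueness all pull back along `e.symm`);
* `LexMaxCentre.weightedMonomialIdeal_map_eq_of_ringEquiv` — UNIQUENESS ⇒ an automorphism `σ` of
  `𝒪` with `σ(I) = I` fixes every piece `(x^α : w·α ≥ n)` of the centre's Rees filtration ("`t · J = J`");
* `LexMaxCentre.eq_of_isLexMaxWeightedCentreGerm` — the reduced data `(w, ℓ)` and the Rees filtration
  are invariants of the germ (two lex-maximal data agree);
* `formallySmooth_fractionRing_mvPolynomial` — `k(t₁, …, tₘ)` is formally smooth (= separable) over `k`: the torus-chart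
  instance of the base-change clause.
PROVED, no facts; lands `--supports stmt-ResolutionOfSingularities-19897 --as helper`. [folklore]
-/

noncomputable section

set_option linter.dupNamespace false -- mandated namespace of this single-conjunct summit

open IsLocalRing Literature.AlgebraicGeometry.Resolution

namespace Summit.ResolutionOfSingularities.ResolutionOfSingularities.Theorems

/-! ## Transport along ring isomorphisms; automorphism invariance; uniqueness of the data -/

namespace LexMaxCentre

variable {𝒪 𝒪' : Type} [CommRing 𝒪] [IsLocalRing 𝒪] [CommRing 𝒪'] [IsLocalRing 𝒪']

/-- The monomial ideals of a weighted chart are transported by ring homomorphisms: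
`(weightedMonomialIdeal x w n).map φ = weightedMonomialIdeal (φ ∘ x) w n` (the tree's Summits-level
`Theorems.weightedMonomialIdeal_map`, restated privately: Literature cannot import Summits). [folklore] -/
private theorem weightedMonomialIdeal_map'
    {A B : Type*} [CommRing A] [CommRing B] (φ : A →+* B) {m : ℕ} (x : Fin m → A) (w : Fin m → ℕ) (n : ℕ) :
    (weightedMonomialIdeal x w n).map φ = weightedMonomialIdeal (fun i => φ (x i)) w n := by
  rw [weightedMonomialIdeal, weightedMonomialIdeal, Ideal.map_span]
  congr 1
  ext b
  constructor
  · rintro ⟨a, ⟨α, hα, rfl⟩, rfl⟩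
    exact ⟨α, hα, by simp [map_prod, map_pow]⟩
  · rintro ⟨α, hα, rfl⟩
    exact ⟨∏ i, x i ^ α i, ⟨α, hα, rfl⟩, by simp [map_prod, map_pow]⟩

/-- **Transport along a ring isomorphism**: if `(x; w; ℓ)` is the lex-maximal admissible weighted centre germ of
`I ⊆ 𝒪`, then `(e ∘ x; w; ℓ)` is the one of `e(I) ⊆ 𝒪'` for every ring isomorphism `e : 𝒪 ≃+* 𝒪'`. [folklore] -/
theorem map_ringEquiv {I : Ideal 𝒪} {x : Fin 2 → 𝒪} {w : Fin 2 → ℕ} {ℓ : ℕ}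
    (h : IsLexMaxWeightedCentreGerm 𝒪 I x w ℓ) (e : 𝒪 ≃+* 𝒪') :
    IsLexMaxWeightedCentreGerm 𝒪' (I.map (e : 𝒪 →+* 𝒪')) (fun i => e (x i)) w ℓ := by
  obtain ⟨hspan, hpos, hcop, hle, hℓ, hdvd, hadm, hmax, huniq⟩ := h
  -- pulling a regular system of parameters of `𝒪'` back to `𝒪`
  have hspan_back : ∀ y : Fin 2 → 𝒪', Ideal.span (Set.range y) = maximalIdeal 𝒪' →
      Ideal.span (Set.range fun i => e.symm (y i)) = maximalIdeal 𝒪 := by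
    intro y hy
    have h1 : Ideal.span (Set.range fun i => e.symm (y i)) = (Ideal.span (Set.range y)).map (e.symm : 𝒪' →+* 𝒪) := by
      rw [Ideal.map_span, ← Set.range_comp]; rfl
    rw [h1, hy]
    exact IsLocalRing.map_maximalIdeal_of_surjective (e.symm : 𝒪' →+* 𝒪) e.symm.surjective
  -- admissibility pulls back along `e.symm`
  have hadm_back : ∀ (y : Fin 2 → 𝒪') (w' : Fin 2 → ℕ) (n : ℕ),
      I.map (e : 𝒪 →+* 𝒪') ≤ weightedMonomialIdeal y w' n → I ≤ weightedMonomialIdeal (fun i => e.symm (y i)) w' n := by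
    intro y w' n hyadm
    have h2 := Ideal.map_mono (f := (e.symm : 𝒪' →+* 𝒪)) hyadm
    rw [Ideal.map_map, weightedMonomialIdeal_map'] at h2
    have h3 : ((e.symm : 𝒪' →+* 𝒪).comp (e : 𝒪 →+* 𝒪')) = RingHom.id 𝒪 := by
      ext a; simp
    rw [h3, Ideal.map_id] at h2
    simpa using h2
  refine ⟨?_, hpos, hcop, hle, hℓ, hdvd, ?_, ?_, ?_⟩
  · -- regular system of parameters
    have h1 : Ideal.span (Set.range fun i => e (x i)) = (Ideal.span (Set.range x)).map (e : 𝒪 →+* 𝒪') := by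
      rw [Ideal.map_span, ← Set.range_comp]; rfl
    rw [h1, hspan]
    exact IsLocalRing.map_maximalIdeal_of_surjective (e : 𝒪 →+* 𝒪') e.surjective
  · -- admissibility
    have := Ideal.map_mono (f := (e : 𝒪 →+* 𝒪')) hadm
    rwa [weightedMonomialIdeal_map'] at this
  · -- lex-maximality: pull the competitor back to `𝒪`
    intro y w' ℓ' hy hw' hle' hℓ' hyadm
    exact hmax (fun i => e.symm (y i)) w' ℓ' (hspan_back y hy) hw' hle' hℓ' (hadm_back y w' ℓ' hyadm)
  · -- uniqueness: pull back, compare in `𝒪`, push forward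
    intro y hy hyadm n
    have h4 := huniq (fun i => e.symm (y i)) (hspan_back y hy) (hadm_back y w ℓ hyadm) n
    have h5 := congrArg (Ideal.map (e : 𝒪 →+* 𝒪')) h4
    rw [weightedMonomialIdeal_map', weightedMonomialIdeal_map'] at h5
    simpa using h5

/-- **Invariance under automorphisms preserving the hypersurface germ** (the use in Abramovich–Quek–Schober §5 (i):
"for every `t ∈ T(k^sep)`, `t · J` is also a center … that satisfies the same properties, so by the uniqueness of
`J`, `t · J = J`"): an automorphism `σ` of `𝒪` with `σ(I) = I` fixes the Rees filtration of the lex-maximal centre.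
[folklore] -/
theorem weightedMonomialIdeal_map_eq_of_ringEquiv {I : Ideal 𝒪} {x : Fin 2 → 𝒪} {w : Fin 2 → ℕ} {ℓ : ℕ}
    (h : IsLexMaxWeightedCentreGerm 𝒪 I x w ℓ) (σ : 𝒪 ≃+* 𝒪) (hσ : I.map (σ : 𝒪 →+* 𝒪) = I) (n : ℕ) :
    (weightedMonomialIdeal x w n).map (σ : 𝒪 →+* 𝒪) = weightedMonomialIdeal x w n := by
  have h' := map_ringEquiv h σ
  rw [hσ] at h'
  obtain ⟨hspan', -, -, -, -, -, hadm', -, -⟩ := h'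
  obtain ⟨-, -, -, -, -, -, -, -, huniq⟩ := h
  rw [weightedMonomialIdeal_map']
  exact huniq (fun i => σ (x i)) hspan' hadm' n

/-- **The reduced centre data is an invariant**: two lex-maximal admissible weighted centre germs of the same
hypersurface germ have the same weights and level, and span the same Rees filtration (Thm 3.5: "well-defined,
unique"). [cite: AbramovichQuekSchober2025, Thm 3.5] -/
theorem eq_of_isLexMaxWeightedCentreGerm {I : Ideal 𝒪} {x y : Fin 2 → 𝒪} {w w' : Fin 2 → ℕ} {ℓ ℓ' : ℕ}
    (h : IsLexMaxWeightedCentreGerm 𝒪 I x w ℓ) (h' : IsLexMaxWeightedCentreGerm 𝒪 I y w' ℓ') :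
    w = w' ∧ ℓ = ℓ' ∧ ∀ n : ℕ, weightedMonomialIdeal y w n = weightedMonomialIdeal x w n := by
  obtain ⟨hspan, hpos, hcop, hle, hℓ, hdvd, hadm, hmax, huniq⟩ := h
  obtain ⟨hspan', hpos', hcop', hle', hℓ', hdvd', hadm', hmax', huniq'⟩ := h'
  have h1 := hmax y w' ℓ' hspan' hpos' hle' hℓ' hadm'
  have h2 := hmax' x w ℓ hspan hpos hle hℓ hadm
  -- the two lex comparisons force equality of both cross products
  have e0 : ℓ' * w 0 = ℓ * w' 0 := by
    rcases h1 with h1 | ⟨h1, -⟩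
    · rcases h2 with h2 | ⟨h2, -⟩ <;> omega
    · exact h1
  have e1 : ℓ' * w 1 = ℓ * w' 1 := by
    rcases h1 with h1 | ⟨-, h1⟩
    · omega
    · rcases h2 with h2 | ⟨-, h2⟩ <;> omega
  -- coprimality: `w = w'`
  have hw0 := hpos 0; have hw1 := hpos 1; have hw0' := hpos' 0; have hw1' := hpos' 1
  have ecross : w 0 * w' 1 = w 1 * w' 0 := by
    have h3 : ℓ' * (w 0 * w' 1) = ℓ' * (w 1 * w' 0) := by
      calc ℓ' * (w 0 * w' 1) = (ℓ' * w 0) * w' 1 := by ring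
        _ = (ℓ * w' 0) * w' 1 := by rw [e0]
        _ = (ℓ * w' 1) * w' 0 := by ring
        _ = (ℓ' * w 1) * w' 0 := by rw [e1]
        _ = ℓ' * (w 1 * w' 0) := by ring
    exact Nat.eq_of_mul_eq_mul_left hℓ' h3
  have hd0 : w 0 ∣ w' 0 := by
    have : w 0 ∣ w 1 * w' 0 := ⟨w' 1, by rw [← ecross]⟩
    exact hcop.dvd_of_dvd_mul_left this
  have hd0' : w' 0 ∣ w 0 := by
    have : w' 0 ∣ w' 1 * w 0 := ⟨w 1, by rw [mul_comm (w' 1), mul_comm (w' 0), ← ecross, mul_comm]⟩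
    exact hcop'.dvd_of_dvd_mul_left this
  have ew0 : w 0 = w' 0 := Nat.dvd_antisymm hd0 hd0'
  have ew1 : w 1 = w' 1 := by
    rw [ew0, mul_comm (w 1)] at ecross
    exact (Nat.eq_of_mul_eq_mul_left hw0' ecross).symm
  have ew : w = w' := by
    funext i
    rcases (by fin_cases i <;> simp : i = 0 ∨ i = 1) with rfl | rfl
    · exact ew0
    · exact ew1
  have eℓ : ℓ = ℓ' := by
    rw [ew0] at e0
    exact (Nat.eq_of_mul_eq_mul_right hw0' e0).symm
  subst ew; subst eℓ
  exact ⟨rfl, rfl, huniq y hspan' hadm'⟩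

end LexMaxCentre

/-! ## The torus-chart instance of the separable base change -/

/-- The function field `k(t₁, …)` of a torus / affine space is FORMALLY SMOOTH over `k` (separably generated): the
instance of `AbramovichQuekSchober2025_separableBaseChange` that a torus-chart consumer uses at the generic point
of `T × 𝒬` (AQS §5). Mathlib: polynomial rings are formally smooth, localizations are formally smooth, composition.
[folklore] -/
theorem formallySmooth_fractionRing_mvPolynomial (k : Type) [Field k] (σ : Type) :
    Algebra.FormallySmooth k (FractionRing (MvPolynomial σ k)) := by
  haveI : Algebra.FormallySmooth (MvPolynomial σ k) (FractionRing (MvPolynomial σ k)) :=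
    Algebra.FormallySmooth.of_isLocalization (nonZeroDivisors (MvPolynomial σ k))
  exact Algebra.FormallySmooth.comp k (MvPolynomial σ k) (FractionRing (MvPolynomial σ k))

end Summit.ResolutionOfSingularities.ResolutionOfSingularities.Theorems

end
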